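import Summits.CriticalPhenomena.PercolationContinuityZ3.Theorems.PercNearOneGluingNoHeavyLowerTailKnQuestion8CoefficientwiseNCStarCycleClusters
import Summits.CriticalPhenomena.PercolationContinuityZ3.Theorems.PercNearOneGluingNoHeavyLowerTailKnQuestion8CoefficientwiseDominationPairing
import HarnessLib

/-!
# NC* on cycles, part 2: the red–blue flip (the dominating injection) — prim-lf-2 gen 65

Support file (`--supports stmt-CriticalPhenomena-4575`, closed), prover `prim-lf-2` (gen 65).  No definitions, no named facts, no sorries; standard axioms.
Memo `prim-lf-2/CW-NCA-gen63.md` §5 (paper proof) and `prim-lf-2/CW-NCDOWN-gen65.md` §4.  Part 1: `…CoefficientwiseNCStarCycleClusters.lean` (the two runs);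
the pairing principle: `…CoefficientwiseDominationPairing.lean`.

Cycle `w 0 = x, …, w L = x`, edges `e 1, …, e L` (`ends (e t) = s(w (t−1), w t)`), `E` = its edge set; colourings `s ⊆ E`; `K s = C_x(s)`, `B s = C_x(E∖s)`.
If `e 1, e L` have the same colour then one cluster is `{x}` and `T(s) ≥ 0`.  If `e 1` is red and `e L` blue, `K s` = the red prefix `w 0..w p` and `B s` = the
blue suffix `w (L−q)..w L`; the RED–BLUE FLIP recolours the blue suffix red and makes the edge `e r'` blue, `r' = max(L−q, p+1)` (the red terminator of the blue
run, or `e (p+1)` when the two runs cover the cycle): the result has `K = K s ∪ B s`, `B = {x}` — it DOMINATES `s` — and `s` is recovered from it.  Colourings with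
`e 1` blue are sent to the complement of the flip of their complement.  `tsum_nonneg_of_dominating_injection` then gives the sums.
* `Coefficientwise.cycle_redBlue_flip` — the flip of a red–blue colouring: edge set, clusters, and the recovery formula.
* (part 3, `…CoefficientwiseNCStarCycle.lean`) `Coefficientwise.nca_cycle` — **THEOREM.**  For every cycle (any length `L ≥ 2`, so digons included), every root on it, all vertex sets `X, W` and all
  monotone `f, g`: `0 ≤ Σ_{s ⊆ E : (∀ v∈X, v ∉ K s ∧ v ∉ B s) ∧ (∀ w∈W, ¬(w ∈ K s ∧ w ∈ B s))} (f (K s) − f (B s))(g (K s) − g (B s))` — CONJECTURE NCA / NC* on cycles.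
  With `nca_glue` (cut-vertex gluing, gen 63) this gives NC*, NO-CORE, `(I1)_X` and `A₀₀` on every CACTUS (and on every graph whose blocks are cycles, single edges
  or other NCA-positive blocks), for every root and all target / avoided sets.
[cite: KozmaNitzan2024, Questions 8–9 (§5.5 p. 36) (context: the Question-8 pocket covariance programme)]
-/

namespace Summit.CriticalPhenomena.PercolationContinuityZ3.Theorems

open Finset Literature.Probability.Percolation

namespace Coefficientwise

variable {ι V : Type*} [DecidableEq ι]

open Classical in
/-- **The red–blue flip on a cycle.**  Cycle data as in part 1, with `e` injective on `[1, L]`.  Let `s ⊆ E` with `e 1 ∈ s`, and let `p, q ≥ 1` be the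
lengths of the red prefix (`e 1..e p ∈ s`, `e (p+1) ∉ s`, `p + 1 ≤ L`) and of the blue suffix (`e t ∉ s` for `L − q < t ≤ L`, `e (L−q) ∈ s`, `q + 1 ≤ L`), and
assume `p + 2 ≤ L` when `p + q = L` (this is what incomparability of the clusters gives).  Put `r' = max (L − q) (p + 1)` and
`φ = (s ∪ {e t : L − q < t ≤ L}).erase (e r')`.  Then: `φ ⊆ E`, `e 1 ∈ φ`; the red prefix of `φ` has length exactly `p` and `e r'` is the LAST blue edge of
`φ`; `C_x(s) ∪ C_x(E∖s) ⊆ C_x(φ) ⊆ C_x(s) ∪ C_x(E∖s)` and `C_x(E∖φ) ⊆ {x}`; and `s` is recovered from `(φ, p, r')`: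
`e t ∈ s ↔ t ≤ p ∨ (p < t < r' ∧ e t ∈ φ) ∨ (t = r' ∧ r' ≠ p + 1)` for `1 ≤ t ≤ L`. [cite: KozmaNitzan2024, Questions 8–9 (§5.5 p. 36) (context)] -/
theorem cycle_redBlue_flip (ends : ι → Sym2 V) (L : ℕ) (w : ℕ → V) (e : ℕ → ι) (x : V) (E : Finset ι)
    (hw0 : w 0 = x) (hwL : w L = x) (hwinj : ∀ i j, i < L → j < L → w i = w j → i = j)
    (he : ∀ t, 1 ≤ t → t ≤ L → ends (e t) = s(w (t - 1), w t))
    (heinj : ∀ t t', 1 ≤ t → t ≤ L → 1 ≤ t' → t' ≤ L → e t = e t' → t = t')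
    (hE : ∀ i, i ∈ E ↔ ∃ t, 1 ≤ t ∧ t ≤ L ∧ e t = i)
    (s : Finset ι) (hs : s ⊆ E) (p q : ℕ)
    (hp1 : 1 ≤ p) (hpL : p + 1 ≤ L) (hp : ∀ t, 1 ≤ t → t ≤ p → e t ∈ s) (hp' : e (p + 1) ∉ s)
    (hq1 : 1 ≤ q) (hqL : q + 1 ≤ L) (hq : ∀ t, L - q < t → t ≤ L → e t ∉ s) (hq' : e (L - q) ∈ s)
    (hpq : p + q = L → p + 2 ≤ L)
    (φ : Finset ι) (hφ : φ = (s ∪ E.filter (fun i => ∃ t, L - q < t ∧ t ≤ L ∧ e t = i)).erase (e (max (L - q) (p + 1)))) :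
    φ ⊆ E ∧ e 1 ∈ φ ∧
    (∀ j, j ≤ L → ((∀ t, 1 ≤ t → t ≤ j → e t ∈ φ) ↔ j ≤ p)) ∧
    (e (max (L - q) (p + 1)) ∉ φ ∧ ∀ t, max (L - q) (p + 1) < t → t ≤ L → e t ∈ φ) ∧
    (openCluster (ends '' (↑s : Set ι)) x ∪ openCluster (ends '' (↑(E \ s) : Set ι)) x ⊆ openCluster (ends '' (↑φ : Set ι)) x) ∧
    (openCluster (ends '' (↑φ : Set ι)) x ⊆ openCluster (ends '' (↑s : Set ι)) x ∪ openCluster (ends '' (↑(E \ s) : Set ι)) x) ∧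
    (openCluster (ends '' (↑(E \ φ) : Set ι)) x ⊆ {x}) ∧
    (∀ t, 1 ≤ t → t ≤ L → (e t ∈ s ↔ (t ≤ p ∨ (p < t ∧ t < max (L - q) (p + 1) ∧ e t ∈ φ) ∨ (t = max (L - q) (p + 1) ∧ max (L - q) (p + 1) ≠ p + 1)))) := by
  set K : Finset ι → Set V := fun s => openCluster (ends '' (↑s : Set ι)) x with hK
  set r := max (L - q) (p + 1) with hr
  -- basic index facts
  have heE : ∀ t, 1 ≤ t → t ≤ L → e t ∈ E := fun t h1 h2 => (hE _).mpr ⟨t, h1, h2, rfl⟩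
  -- `p + q ≤ L` and `p + q ≠ L - 1`
  have hpq_le : p + q ≤ L := by
    by_contra h
    exact hq p (by omega) (by omega) (hp p hp1 le_rfl)
  have hpq_ne : p + 1 ≠ L - q := fun h => hp' (h ▸ hq')
  have hr1 : 2 ≤ r := by simp only [hr]; omega
  have hrL : r ≤ L := by
    simp only [hr]
    rcases Nat.lt_or_ge (p + q) L with h | h
    · omega
    · have := hpq (le_antisymm hpq_le h); omega
  -- membership in `φ` for the cycle edges
  have memφ : ∀ t, 1 ≤ t → t ≤ L → (e t ∈ φ ↔ (e t ∈ s ∨ L - q < t) ∧ t ≠ r) := by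
    intro t h1 h2
    rw [hφ, Finset.mem_erase, Finset.mem_union, Finset.mem_filter]
    constructor
    · rintro ⟨hne, hmem⟩
      refine ⟨?_, fun htr => hne (by rw [htr])⟩
      rcases hmem with hmem | ⟨_, t', ht'1, ht'2, ht'e⟩
      · exact Or.inl hmem
      · have : t' = t := heinj t' t (by omega) ht'2 h1 h2 ht'e
        right; omega
    · rintro ⟨hmem, hne⟩
      refine ⟨fun h => hne (heinj t r h1 h2 (by omega) hrL h), ?_⟩
      rcases hmem with hmem | hlt
      · exact Or.inl hmem
      · exact Or.inr ⟨heE t h1 h2, t, hlt, h2, rfl⟩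
  have hφE : φ ⊆ E := by
    intro i hi
    rw [hφ, Finset.mem_erase, Finset.mem_union] at hi
    rcases hi.2 with h | h
    · exact hs h
    · exact (Finset.mem_filter.mp h).1
  have he1φ : e 1 ∈ φ := (memφ 1 le_rfl (by omega)).mpr ⟨Or.inl (hp 1 le_rfl hp1), by omega⟩
  have heLφ : e L ∈ φ := (memφ L (by omega) le_rfl).mpr ⟨Or.inr (by omega), by omega⟩
  -- the red prefix of `φ` has length `p`
  have preφ : ∀ j, j ≤ L → ((∀ t, 1 ≤ t → t ≤ j → e t ∈ φ) ↔ j ≤ p) := by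
    intro j hj
    constructor
    · intro h
      by_contra hjp
      have h' := (memφ (p + 1) (by omega) hpL).mp (h (p + 1) (by omega) (by omega))
      rcases h'.1 with h'' | h''
      · exact hp' h''
      · simp only [hr] at h'; omega
    · intro hjp t h1 h2
      exact (memφ t h1 (by omega)).mpr ⟨Or.inl (hp t h1 (by omega)), by simp only [hr]; omega⟩
  -- `e r` is the last blue edge of `φ`
  have herφ : e r ∉ φ := fun h => ((memφ r (by omega) hrL).mp h).2 rfl
  have sufφ : ∀ t, r < t → t ≤ L → e t ∈ φ := by
    intro t h1 h2
    exact (memφ t (by omega) h2).mpr ⟨Or.inr (by simp only [hr] at h1; omega), by omega⟩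
  -- the two runs of `φ`: `w j ∈ K φ ↔ j ≤ p ∨ r ≤ j`
  have runφ : ∀ j, j ≤ L → ((∀ t, 1 ≤ t → t ≤ j → e t ∈ φ) ∨ (∀ t, j < t → t ≤ L → e t ∈ φ) ↔ (j ≤ p ∨ r ≤ j)) := by
    intro j hj
    rw [preφ j hj]
    constructor
    · rintro (h | h)
      · exact Or.inl h
      · right; by_contra hjr
        exact herφ (h r (by omega) hrL)
    · rintro (h | h)
      · exact Or.inl h
      · exact Or.inr (fun t h1 h2 => sufφ t (by omega) h2)
  -- clusters of `s`: `w j ∈ K s ↔ j ≤ p ∨ j = L`, `w j ∈ B s ↔ j = 0 ∨ L - q ≤ j`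
  have heLs : e L ∉ s := hq L (by omega) le_rfl
  have runs_s : ∀ j, j ≤ L → (((∀ t, 1 ≤ t → t ≤ j → e t ∈ s) ∨ (∀ t, j < t → t ≤ L → e t ∈ s)) → (j ≤ p ∨ r ≤ j)) := by
    intro j hj h
    rcases h with h | h
    · left; by_contra hjp
      exact hp' (h (p + 1) (by omega) (by omega))
    · by_cases hjL : j = L
      · right; omega
      · exact absurd (h L (by omega) le_rfl) heLs
  have memEs : ∀ t, 1 ≤ t → t ≤ L → (e t ∈ E \ s ↔ e t ∉ s) := by
    intro t h1 h2; rw [Finset.mem_sdiff]; exact ⟨fun h => h.2, fun h => ⟨heE t h1 h2, h⟩⟩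
  have runs_Es : ∀ j, j ≤ L → (((∀ t, 1 ≤ t → t ≤ j → e t ∈ E \ s) ∨ (∀ t, j < t → t ≤ L → e t ∈ E \ s)) → (j ≤ p ∨ r ≤ j)) := by
    intro j hj h
    rcases h with h | h
    · by_cases hj0 : j = 0
      · left; omega
      · exact absurd (hp 1 le_rfl hp1) ((memEs 1 le_rfl (by omega)).mp (h 1 le_rfl (by omega)))
    · -- blue suffix from `j`: then `L - q ≤ j`, and if moreover `p + 1 ≤ j` we are done; else `j ≤ p`
      by_cases hjq : L - q ≤ j
      · rcases Nat.lt_or_ge j (p + 1) with h' | h'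
        · left; omega
        · right; simp only [hr]; omega
      · exfalso
        exact (memEs (L - q) (by omega) (by omega)).mp (h (L - q) (by omega) (by omega)) hq'
  -- (dominates) `K s ∪ B s ⊆ K φ ⊆ K s ∪ B s`
  have hsub1 : K s ∪ K (E \ s) ⊆ K φ := by
    rintro v (hv | hv)
    · obtain ⟨j, hj, rfl, hrun⟩ := cycle_openCluster_subset_runs ends L w e x E hw0 hwL hwinj he hE s hs hv
      exact (cycle_mem_openCluster_iff ends L w e x E hw0 hwL hwinj he hE φ hφE hj).mpr ((runφ j hj).mpr (runs_s j hj hrun))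
    · obtain ⟨j, hj, rfl, hrun⟩ := cycle_openCluster_subset_runs ends L w e x E hw0 hwL hwinj he hE (E \ s) Finset.sdiff_subset hv
      exact (cycle_mem_openCluster_iff ends L w e x E hw0 hwL hwinj he hE φ hφE hj).mpr ((runφ j hj).mpr (runs_Es j hj hrun))
  have hsub2 : K φ ⊆ K s ∪ K (E \ s) := by
    intro v hv
    obtain ⟨j, hj, rfl, hrun⟩ := cycle_openCluster_subset_runs ends L w e x E hw0 hwL hwinj he hE φ hφE hv
    rcases (runφ j hj).mp hrun with hjp | hjr
    · exact Or.inl ((cycle_mem_openCluster_iff ends L w e x E hw0 hwL hwinj he hE s hs hj).mpr (Or.inl (fun t h1 h2 => hp t h1 (by omega))))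
    · refine Or.inr ((cycle_mem_openCluster_iff ends L w e x E hw0 hwL hwinj he hE (E \ s) Finset.sdiff_subset hj).mpr (Or.inr ?_))
      intro t h1 h2
      exact (memEs t (by omega) h2).mpr (hq t (by simp only [hr] at hjr; omega) h2)
  -- `B φ ⊆ {x}`: both root edges of `φ` are red
  have hsub3 : K (E \ φ) ⊆ {x} := by
    intro v hv
    obtain ⟨j, hj, rfl, hrun⟩ := cycle_openCluster_subset_runs ends L w e x E hw0 hwL hwinj he hE (E \ φ) Finset.sdiff_subset hv
    rcases hrun with h | h
    · by_cases hj0 : j = 0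
      · rw [hj0, hw0]; rfl
      · exact absurd he1φ (Finset.mem_sdiff.mp (h 1 le_rfl (by omega))).2
    · by_cases hjL : j = L
      · rw [hjL, hwL]; rfl
      · exact absurd heLφ (Finset.mem_sdiff.mp (h L (by omega) le_rfl)).2
  -- recovery of `s`
  have hrec : ∀ t, 1 ≤ t → t ≤ L → (e t ∈ s ↔ (t ≤ p ∨ (p < t ∧ t < r ∧ e t ∈ φ) ∨ (t = r ∧ r ≠ p + 1))) := by
    intro t h1 h2
    constructor
    · intro hts
      rcases Nat.lt_or_ge p t with hpt | hpt
      · right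
        have htq : t ≤ L - q := by by_contra h'; exact hq t (by omega) h2 hts
        rcases Nat.lt_or_ge t r with htr | htr
        · exact Or.inl ⟨hpt, htr, (memφ t h1 h2).mpr ⟨Or.inl hts, by omega⟩⟩
        · right; simp only [hr] at htr ⊢; constructor <;> omega
      · exact Or.inl hpt
    · rintro (h | ⟨h1', h2', h3'⟩ | ⟨htr, hne⟩)
      · exact hp t h1 h
      · rcases ((memφ t h1 h2).mp h3').1 with h' | h'
        · exact h'
        · exfalso; simp only [hr] at h2'; omega
      · have : t = L - q := by simp only [hr] at htr hne; omega
        rw [this]; exact hq'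
  exact ⟨hφE, he1φ, preφ, ⟨herφ, sufφ⟩, hsub1, hsub2, hsub3, hrec⟩

end Coefficientwise

end Summit.CriticalPhenomena.PercolationContinuityZ3.Theorems
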